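import Summits.BirchSwinnertonDyer.BirchSwinnertonDyer.Theorems.GenusKolyvaginAtTwoEquivariantKolyvaginExactAtTwoTwistInfRes
import Literature.NumberTheory.EllipticCurves.SelmerTorsionRestriction
import Literature.NumberTheory.EllipticCurves.TwoTorsionOddDegreeBaseChangeProofs
import Literature.NumberTheory.EllipticCurves.SelmerCorankProofs
import HarnessLib

/-!
# Route `CMKolyvaginAtInertTwo`, crux `CMKolyvaginExactAtInertTwo` (stmt-BirchSwinnertonDyer-24277):
# the binder (inj) and the `H¹`-half of (desc) of the over-`ℚ` bit DISCHARGED —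
# `res : H¹(ℚ, E[n]) ≅ H¹(K, E[n])^{Gal(K/ℚ)}` at FINITE level when `E[n]^{Γ_K} = 0`, and
# `E[2]^{Γ_K} = 0` for `ρ̄_{E,2}` onto and `K` quadratic

Seat `bsd-line-cmk2-p1` g8 (cell `bsd-print-cf2`); helper (`--supports stmt-BirchSwinnertonDyer-24277`);
third file of the over-`ℚ` bit (after `…RationalDescentAtTwo`, `…RationalDescentAtTwoHabitat`). THEOREMS
ONLY: no definition, no named fact, no `sorry`; no item is closed; BSD is not proved by this.

The over-`ℚ` descent (`…RationalDescentAtTwoHabitat.selmer_two_eq_zero_or_eq_kummer_of_cmInert_families`)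
was landed modulo four binders; two of them are pure Galois cohomology at FINITE level `n`:
(inj) `res : H¹(ℚ, E[n]) → H¹(K, E[n])` injective and (the `H¹`-half of desc) every `Gal(K/ℚ)`-invariant
class of `H¹(K, E[n])` is a restriction — inflation–restriction with `H¹(K/ℚ, E[n](K)) = 0 = H²(…)`
because `E[n]^{Γ_K} = 0`. The tree has this at the `p^∞` level (gk2-p3's `…QuadInfRes`, p61xxxx) and at
finite level for odd `p` (`resTorsion_injective_of_odd`, `exists_resTorsion_eq_of_conjAct_eq`) and for
`j = 0`, `K = ℚ(ζ₃)` (`SelmerTorsionRestrictionJZero`); here: finite level, ANY `n`, any Galois quadratic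
`K`, under `E[n]^{galRange K} = 0`, by transporting gk2-p3's generic absolute-model theorems
(`GenusExact.TwistInfRes.resSubgroupH1_injective_of_fixedPoints_eq_bot`,
`…mem_range_resSubgroupH1_iff_forall_conjH1_eq`, p617370) along the tree's finite-level subgroup model
(`modelIsoTorsion`, `modelIsoTorsion_resTorsion`, `modelIsoTorsion_conjAct`).

* §1 `fixedPoints_galRange_geomTorsion_two_eq_bot` — `ρ̄_{E,2}` onto and `3 ∤ [K : ℚ]` ⟹ no non-zero
  point of `E[2] ⊆ E(ℚ̄)` is fixed by `galRange K` (`E(K)[2] = 0`, tree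
  `forall_two_zsmul_baseChange_of_hasSurjectiveModNGaloisRep_two`, transported by `torsionBaseChangeMap`
  and Galois descent `exists_toGeomPoints_eq_of_forall_smul_eq`).
* §2 `resTorsion_injective_of_fixedPoints_eq_bot`, `exists_resTorsion_eq_of_conjAct_eq_of_fixedPoints_eq_bot`
  — the finite-level inflation–restriction isomorphism for a Galois quadratic `K` with `σ₀ ≠ 1`.
* §3 at `n = 2` on the items' habitat (`ρ̄₂` onto, `K` imaginary quadratic, `c ≠ 1`):
  `resTorsion_two_injective`, `exists_resTorsion_two_eq_of_conjAct_eq` — the binder (inj) of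
  `…RationalDescentAtTwoHabitat` BY NAME, and the `H¹`-half of (desc) (what remains of (desc) is local:
  a descended Selmer class satisfies the Selmer condition over `ℚ` at the places `≠ q`).

References: [SerreGaloisCohomology1997] I §2.6 (b); [GrossLMS1991] §5 (5.1); [DokchitserDokchitserMathZ2012]
Theorem (1) (`ρ̄₂` onto ⟹ no rational `2`-torsion over fields of degree prime to `3`).
-/

-- single-conjunct summit: `Summit.BirchSwinnertonDyer.BirchSwinnertonDyer.…` repeats the name by design
set_option linter.dupNamespace false
set_option autoImplicit false

noncomputable section

open scoped Classical
open WeierstrassCurve NumberField IsDedekindDomain Field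
open Literature.NumberTheory.GaloisRepresentations Literature.NumberTheory.EllipticCurves

namespace Summit.BirchSwinnertonDyer.BirchSwinnertonDyer.Theorems.KolyvaginRatDescentTwo

variable (K : Type) [Field K] [NumberField K] (W : WeierstrassCurve ℚ) (n : ℤ)

/-- The `Γ_ℚ`-orbit maps of `E[n]` are continuous (discrete coefficients: open stabilizers).
[folklore] -/
private theorem continuous_smul_geomTorsion (m : geomTorsion W n) :
    Continuous fun g : Field.absoluteGaloisGroup ℚ ↦ g • m :=
  continuous_induced_rng.2 (by
    change Continuous fun g : Field.absoluteGaloisGroup ℚ ↦ ((g • m : geomTorsion W n) : geomPoints W)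
    simp only [AddSubgroup.torsionBy.coe_smul]
    exact continuous_smul_of_isOpen_stabilizer (m : geomPoints W) (isOpen_stabilizer_point_holds W _))

/-! ## §1 `E[2]^{Γ_K} = 0` from `ρ̄_{E,2}` onto -/

/-- **No non-zero `galRange K`-fixed point of `E[2] ⊆ E(ℚ̄)`** for `E/ℚ` elliptic with `ρ̄_{E,2}` onto
and `3 ∤ [K : ℚ]` (e.g. `K` quadratic): transport a fixed point to `E_K[2](K̄)` (`torsionBaseChangeMap`,
equivariant along `resGal`), descend it to `E(K)[2]` (Galois descent) and use `E(K)[2] = 0`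
(`forall_two_zsmul_baseChange_of_hasSurjectiveModNGaloisRep_two`). [cite: DokchitserDokchitserMathZ2012, Theorem (1)]
[cite: GrossLMS1991, §2 (E(K)_p = 0)] -/
theorem fixedPoints_galRange_geomTorsion_two_eq_bot [W.IsElliptic] (hs : W.HasSurjectiveModNGaloisRep 2)
    (hK3 : ¬ 3 ∣ Module.finrank ℚ K) :
    FixedPoints.addSubgroup (galRange (K := ℚ) K) (geomTorsion W ((2 : ℕ) : ℤ)) = ⊥ := by
  rw [eq_bot_iff]
  intro m hm
  rw [AddSubgroup.mem_bot]
  have hm' : ∀ g : galRange (K := ℚ) K, g • m = m := fun g ↦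
    (FixedPoints.mem_addSubgroup _ _ _).1 hm g
  set m₁ := torsionBaseChangeMap W K ((2 : ℕ) : ℤ) m with hm₁
  have hfix : ∀ σ : Field.absoluteGaloisGroup K,
      σ • (m₁ : geomPoints (W.baseChange K)) = (m₁ : geomPoints (W.baseChange K)) := fun σ ↦ by
    have h : resGal (K := ℚ) K σ • m = m := by
      have := hm' ⟨resGal (K := ℚ) K σ, ⟨σ, rfl⟩⟩
      rwa [Subgroup.smul_def] at this
    rw [← AddSubgroup.torsionBy.coe_smul, ← torsionBaseChangeMap_smul, h]
  obtain ⟨P, hP⟩ := exists_toGeomPoints_eq_of_forall_smul_eq (W.baseChange K) hfix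
  have h2m : (2 : ℕ) • m₁ = 0 := AddSubgroup.torsionBy.nsmul m₁
  have h2P : (2 : ℤ) • P = 0 := by
    apply toGeomPoints_injective (W.baseChange K)
    rw [map_zsmul, hP, map_zero, show (2 : ℤ) = ((2 : ℕ) : ℤ) by rfl, natCast_zsmul,
      ← AddSubmonoidClass.coe_nsmul, h2m, ZeroMemClass.coe_zero]
  have hP0 : P = 0 := forall_two_zsmul_baseChange_of_hasSurjectiveModNGaloisRep_two W hs K hK3 P h2P
  have hm₁0 : m₁ = 0 := by
    apply Subtype.ext
    rw [← hP, hP0, map_zero, ZeroMemClass.coe_zero]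
  apply torsionBaseChangeMap_injective W K ((2 : ℕ) : ℤ)
  rw [map_zero]
  exact hm₁0

/-! ## §2 Inflation–restriction at finite level for a Galois quadratic `K` -/

/-- **`res : H¹(ℚ, E[n]) → H¹(K, E[n])` is injective when `E[n]^{Γ_K} = 0`** (`K` Galois quadratic,
`σ₀ ≠ 1`): gk2-p3's `resSubgroupH1_injective_of_fixedPoints_eq_bot` in the subgroup model
(`modelIsoTorsion_resTorsion`). [cite: SerreGaloisCohomology1997, I §2.6 (b)] -/
theorem resTorsion_injective_of_fixedPoints_eq_bot [IsGalois ℚ K] (h2 : Module.finrank ℚ K = 2)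
    {σ₀ : K ≃ₐ[ℚ] K} (hσ₀ : σ₀ ≠ 1)
    (hfix : FixedPoints.addSubgroup (galRange (K := ℚ) K) (geomTorsion W n) = ⊥) :
    Function.Injective (resTorsion W K n) := by
  haveI := normal_galRange K h2 hσ₀
  haveI : Algebra.IsAlgebraic ℚ K := Algebra.IsAlgebraic.of_finite ℚ K
  have hinj := GenusExact.TwistInfRes.resSubgroupH1_injective_of_fixedPoints_eq_bot
    (galRange (K := ℚ) K) (continuous_smul_geomTorsion W n) hfix
  intro x y hxy
  have h := congrArg (modelIsoTorsion K W n) hxy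
  rw [modelIsoTorsion_resTorsion, modelIsoTorsion_resTorsion] at h
  exact hinj h

/-- **Every `σ₀`-invariant class of `H¹(K, E[n])` is a restriction when `E[n]^{Γ_K} = 0`** (`K` Galois
quadratic, `σ₀ ≠ 1`): gk2-p3's `mem_range_resSubgroupH1_iff_forall_conjH1_eq` in the subgroup model
(`modelIsoTorsion_conjAct`, `Γ_ℚ = galRange K ⊔ galRange K · c₀`). With the previous theorem:
`res : H¹(ℚ, E[n]) ≅ H¹(K, E[n])^{σ₀}`. [cite: SerreGaloisCohomology1997, I §2.6 (b)]
[cite: GrossLMS1991, §5 (5.1)] -/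
theorem exists_resTorsion_eq_of_conjAct_eq_of_fixedPoints_eq_bot [IsGalois ℚ K]
    (h2 : Module.finrank ℚ K = 2) {σ₀ : K ≃ₐ[ℚ] K} (hσ₀ : σ₀ ≠ 1)
    (hfix : FixedPoints.addSubgroup (galRange (K := ℚ) K) (geomTorsion W n) = ⊥)
    {y : galH1Torsion (W.baseChange K) n} (hy : conjAct W σ₀ n y = y) :
    ∃ x : galH1Torsion W n, resTorsion W K n x = y := by
  haveI := normal_galRange K h2 hσ₀
  haveI : Algebra.IsAlgebraic ℚ K := Algebra.IsAlgebraic.of_finite ℚ K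
  set c₀ := liftToAbsGal (K := ℚ) K σ₀ with hc₀
  set y' := modelIsoTorsion K W n y with hy'
  have hfix1 : conjH1 (galRange (K := ℚ) K) (geomTorsion W n) c₀ y' = y' := by
    rw [hy', ← modelIsoTorsion_conjAct K W n σ₀ h2 hσ₀, hy]
  have hgen : ∀ g : Field.absoluteGaloisGroup ℚ,
      ∃ (m : galRange (K := ℚ) K) (k : ℕ), g = m * c₀ ^ k := by
    intro g
    rcases xor_galRange K h2 hσ₀ g with ⟨hg, -⟩ | ⟨hg, -⟩
    · exact ⟨⟨g * c₀⁻¹, hg⟩, 1, by rw [pow_one, Subgroup.coe_mk, inv_mul_cancel_right]⟩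
    · exact ⟨⟨g, hg⟩, 0, by rw [pow_zero, mul_one]⟩
  have hall : ∀ g : Field.absoluteGaloisGroup ℚ,
      conjH1 (galRange (K := ℚ) K) (geomTorsion W n) g y' = y' :=
    conjH1_eq_self_of_generator (galRange (K := ℚ) K) hgen hfix1
  obtain ⟨x, hx⟩ := (GenusExact.TwistInfRes.mem_range_resSubgroupH1_iff_forall_conjH1_eq
    (galRange (K := ℚ) K) (isOpen_galRange K) (continuous_smul_geomTorsion W n) hfix y').mpr hall
  refine ⟨x, (modelIsoTorsion K W n).injective ?_⟩
  rw [modelIsoTorsion_resTorsion, hx]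

/-! ## §3 At `n = 2` on the items' habitat: `ρ̄_{E,2}` onto, `K` imaginary quadratic -/

/-- **(inj) of the over-`ℚ` bit, BY NAME: `res : H¹(ℚ, E[2]) → H¹(K, E[2])` is injective** for `E/ℚ`
with `ρ̄_{E,2}` onto and `K` imaginary quadratic with a non-trivial automorphism `c` (the binder `hinj`
of `…RationalDescentAtTwoHabitat.selmer_two_eq_zero_or_eq_kummer_of_cmInert_families`, there written at
level `((2 ^ 1 : ℕ) : ℤ)`; `pow_one` converts). [cite: SerreGaloisCohomology1997, I §2.6 (b)]
[cite: DokchitserDokchitserMathZ2012, Theorem (1)] -/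
theorem resTorsion_two_injective [W.IsElliptic] (hs : W.HasSurjectiveModNGaloisRep 2)
    (hK : IsImaginaryQuadratic K) {c : K ≃ₐ[ℚ] K} (hc : c ≠ 1) :
    Function.Injective (resTorsion W K ((2 : ℕ) : ℤ)) := by
  haveI : Algebra.IsQuadraticExtension ℚ K := ⟨hK.1⟩
  exact resTorsion_injective_of_fixedPoints_eq_bot K W _ hK.1 hc
    (fixedPoints_galRange_geomTorsion_two_eq_bot K W hs (by rw [hK.1]; decide))

/-- **The `H¹`-half of (desc), BY NAME: every `c`-invariant class of `H¹(K, E[2])` is `res ξ`** for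
`E/ℚ` with `ρ̄_{E,2}` onto, `K` imaginary quadratic, `c ≠ 1`. (What remains of the binder (desc) is
local: a `ξ` with `res ξ ∈ Sel₂(E/K)` satisfies the Selmer condition over `ℚ` at every place of `ℚ`
other than the ramified prime `q = −d_K` — split places, unramified places of good reduction incl. `2`
(Milne ADT I.3.8), and `∞` (`Δ_E < 0`).) [cite: SerreGaloisCohomology1997, I §2.6 (b)]
[cite: GrossLMS1991, §5 (5.1)] -/
theorem exists_resTorsion_two_eq_of_conjAct_eq [W.IsElliptic] (hs : W.HasSurjectiveModNGaloisRep 2)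
    (hK : IsImaginaryQuadratic K) {c : K ≃ₐ[ℚ] K} (hc : c ≠ 1)
    {y : galH1Torsion (W.baseChange K) ((2 : ℕ) : ℤ)} (hy : conjAct W c ((2 : ℕ) : ℤ) y = y) :
    ∃ x : galH1Torsion W ((2 : ℕ) : ℤ), resTorsion W K ((2 : ℕ) : ℤ) x = y := by
  haveI : Algebra.IsQuadraticExtension ℚ K := ⟨hK.1⟩
  exact exists_resTorsion_eq_of_conjAct_eq_of_fixedPoints_eq_bot K W _ hK.1 hc
    (fixedPoints_galRange_geomTorsion_two_eq_bot K W hs (by rw [hK.1]; decide)) hy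

end Summit.BirchSwinnertonDyer.BirchSwinnertonDyer.Theorems.KolyvaginRatDescentTwo

end
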